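import Summits.Parity.GeneralizedHardyLittlewood.Theses.PolynomialKatai

/-!
# Birth skeleton (BC3) — crux stmt-Parity-18777 `Theses.PolynomialKatai.PrimeMultiplierChowla` (rank 2, "the door")
# line `birth`: the door splits by the ORIENTATION of its dilated form — TABLE orientation
# `λ(u)·λ(apu + Δ)` (`a ≥ 1`: ascending shifted multiplication table with prime multipliers) and
# GOLDBACH orientation `λ(u)·λ(Δ − bpu)` (`b ≥ 1`, `Δ > 0`: λ-weighted representations `Δ = bp·u + v`)

Registered by the skeleton registrar (planner one-shot `planner-skel-stmt-Parity-18777-0`,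
2026-08-17; BC3 of `run/shared/lean/lens3/_common/BC.md`). Route `route-Parity-PolynomialKatai`
(the crux is the route's ENTIRE λ-side parity input: `KataiTransfer : PrimeMultiplierChowla →
ChowlaNatural` is its provable-now lever). Two NAMED stubs and the kernel-checked composition
`PrimeMultiplierChowla_of` concluding the crux BY NAME; `primeMultiplierChowla_of_stubs` plugs the
stubs in (and thereby checks that the `Sig.*` legend is the stub signatures verbatim).

## The crux (FIXED; verbatim the route decl)

`PrimeMultiplierChowla`: for every `L ≥ 1`, `ε > 0`, `δ > 0`, eventually in `X`: for every `P` with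
`X^δ ≤ P ≤ X^{1/4}`, every dilation `a ∈ ℤ`, `0 < |a| ≤ L`, class modulus `1 ≤ k ≤ L`, shift
`Δ ≠ 0`, `|Δ| ≤ LX`, and every choice of classes `e(p)` and intervals `[lo p, hi p]` with
`hi(p)·P ≤ LX`:
`Σ_{p prime ∈ (P,2P]} |Σ_{u ∈ [lo p, hi p], u ≡ e(p) (k)} λ(u)·λ(apu + Δ)| ≤ ε·X / log P`
(`λ` of a non-positive value is `λ(0) = 0` through `Int.toNat`; trivial bound `≍ L·X / log P`).

## The cut — by orientation (the sign of the dilation `a`), mirroring the T/G cut of the sibling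
## crux `ChowlaNatural` (Cruxes/ChowlaNatural/Lines/birth.lean) one level up the lever

`λ` lives on the positive integers, so the door is two different statements according to the sign of
`a` (no reflection relates them), exactly as a pair system `(a₁n + b₁, a₂n + b₂)`, `a₁ > 0`, is of
twin shape (`a₂ > 0`) or Goldbach shape (`a₂ < 0`); and `KataiTransfer`'s identity
`Z(p, c_p) = −λ(a₁)·Σ_u λ(u)λ⁺(a₂pu + Δ)` sends twin-shape systems to the door with `a = a₂ > 0` and
Goldbach-shape systems to the door with `a = a₂ < 0`. By complete multiplicativity
(`λ(apu) = λ(ap)λ(u)`, `λ(p) = −1`) the two orientations read: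

* `stub_tableOrientation` (T, OPEN): the door verbatim with `1 ≤ a ≤ L` in place of `0 < |a| ≤ L`
  — `Σ_{p∼P} |Σ_u λ(u)λ(apu + Δ)| ≤ εX/log P`, `Δ ≠ 0` of either sign. Equivalently (multiply by
  `λ(ap) = ±1`): `Σ_{p∼P} |Σ_{n ∈ I_p, n ≡ c_p (apk)} λ(n)λ(n + Δ)| = o(X / log P)` — TWO-POINT CHOWLA
  `λ(n)λ(n+h)`, `h = Δ`, on the class of `n` DIVISIBLE BY `ap` (for `Δ < 0`: write `m = n + Δ`, the
  class of the point `m ≡ −h`), at natural density, averaged in `ℓ¹` over the `≍ P/log P` prime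
  moduli `p ∈ (P, 2P]`, `P ∈ [X^δ, X^{1/4}]`: the ascending SHIFTED MULTIPLICATION TABLE
  `{λ(ap·u + Δ)}_{p,u}` tested against `λ(u)`. Why it might fail: Chowla-complete from below on twin
  shapes (KataiTransfer restricted to `a₂ > 0` lands on natural-density `λ(n)λ(n+h)`, open:
  LogarithmicAveraging barrier) and Siegel-complete in `Δ` (`λ ≈ χ (mod q)`, `q ∣ Δ`: the complete
  sums `Σ_u χ(u)χ(apu + Δ) = χ(ap)φ(q)·(…)` do not cancel); the one-point shadow (λ in APs to almost
  all prime moduli) is Klurman–Mangerel–Teräväinen, the log-averaged fixed-coefficient form is Tao's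
  theorem (tree fact `Literature.NumberTheory.Sieve.tao_log_chowla_liouville`), neither reaches it.
* `stub_goldbachOrientation` (G, OPEN): the door for NEGATIVE dilations, written with `b = −a`,
  `1 ≤ b ≤ L`, and `0 < Δ ≤ LX` — `Σ_{p∼P} |Σ_u λ(u)λ(Δ − bpu)| ≤ εX/log P`. Equivalently
  `Σ_{p∼P} |Σ_{n ∈ I_p, n ≡ c_p (bpk)} λ(n)λ(Δ − n)| = o(X / log P)`: the EVEN-GOLDBACH problem for λ
  (`Σ_{n + m = Δ} λ(n)λ(m)` weighted representations) restricted to the summand `n` divisible by `bp`,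
  averaged over the prime moduli `p ∼ P`, uniformly in the target `Δ ≤ LX` (trivial unless
  `Δ ≫ ε·P·(X/P)/L`, i.e. this is the LARGE-SHIFT regime of the route header's two-layer plan:
  "GoldbachRegime … descending tables λ(Δ − |a|pu), where the shift-uniform Siegel content lives").
  For `Δ ≤ 0` every summand vanishes (`doorTerm_eq_zero`, proved), which is why G carries `0 < Δ`.
  Why it might fail: Goldbach orientation has no shift to average along — even the logarithmically
  averaged fixed-coefficient analogue is NOT Tao's theorem; only almost-all-targets results are
  known (MRT-type, averaged over `Δ`); Siegel-complete in `Δ` (`q_exc ∣ Δ`).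

Composition `PrimeMultiplierChowla_of : T → G → PrimeMultiplierChowla` (REAL proof, this file): take
`X₀ = max X₀ᵀ X₀ᴳ`; for `a > 0` apply T (`1 ≤ a ≤ L` from `0 < a`, `|a| ≤ L`); for `a < 0` and
`Δ > 0` apply G with `b = −a` and the ring identity `Δ − (−a)pu = apu + Δ` under the sums; for
`a < 0` and `Δ < 0` every dilated argument `apu + Δ` is negative, so every summand is
`λ(u)·λ(0) = 0` and the bound is `0 ≤ εX / log P` (`Real.log_natCast_nonneg`). So T ∧ G ⟺ the crux
(the converse is the restriction to `a > 0`, resp. `a = −b < 0`; not needed here). Neither stub is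
bookkeeping: each is an open natural-density two-point statement carrying half of the door, and
the seam is the honest case split by orientation (`trivial_seam` in the sense of BC2 — flagged, not
hidden: all difficulty sits in the two NAMED stubs, none in an unnamed step).

Sanity (no `sorry`): `doorTerm_eq_zero` (Goldbach orientation with `Δ ≤ 0` vanishes termwise),
`door_rhs_nonneg`. Neither stub gives the crux or the summit cheaply (BC3 probes, registrar folder
`bc/probe_T.lean`, `bc/probe_G.lean`: `stub → PrimeMultiplierChowla`, `stub → GeneralizedHardyLittlewood`
by `first | exact? | simpa [Sig] | (unfold Sig; simpa) | aesop` and by `unfold; intro; exact?` all FAIL —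
see `Lines/birth.md`).

Disproof / negatives honoured. No `Disproof.lean` exists for this crux (`ledger crux ls
stmt-Parity-18777`: no workfiles at registration). Two LANDED negative lemmas
(`Theorems/PrimeMultiplierChowla/Negative/`): `primeMultiplierChowla_false_without_shiftNonzero`
(guard `Δ ≠ 0` load-bearing; witness `Δ = 0`, `a = k = 1` — a TABLE-orientation instance: T keeps
`Δ ≠ 0`; in G the value `Δ = 0` is vacuous, `doorTerm_eq_zero`) and
`primeMultiplierChowla_false_without_cap` (cap `P ≤ X^{1/4}` load-bearing; witness `X = P`,
`a = 1`, `Δ = 1`: both stubs keep the cap verbatim). Neither stub is an instance of a refuted type: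
each is the crux with MORE hypotheses on `a` (and, for G, on `Δ`), never fewer. Negatives index
(`ledger negatives --problem Parity`): no statement of this shape.
Barriers: `Literature.Barriers.Parity.LogarithmicAveraging` — NOT evaded by the stubs themselves (both
are natural-density statements; the route's evasion is in the lever KataiTransfer, and the bet of the
crux is that the ℓ¹-average over ≍ P/log P prime slopes is attackable where pointwise Chowla is not);
`SiegelZeroTwinPrimes`-type obstruction — declared, inherited from the crux and split between T
(`q_exc ∣ Δ`, either sign) and G (`q_exc ∣ Δ > 0`); `SelbergParityBarrier`, `PrimePairParity`,
`CircleMethodBinaryBarrier`, `LargeSieveLevelHalf` — not in their classes (pure λ-correlations, no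
sieve weights, no minor arcs, no level of distribution).
-/

set_option linter.dupNamespace false

noncomputable section

open scoped BigOperators Classical

namespace Summit.Parity.GeneralizedHardyLittlewood.Cruxes.PrimeMultiplierChowla.Birth

open Summit.Parity.GeneralizedHardyLittlewood.Theses.PolynomialKatai (PrimeMultiplierChowla)

/-! ## Legend: the two stub statements as named propositions (verbatim the registered signatures) -/

/-- Statement of `stub_tableOrientation` (T): the door for positive dilations `1 ≤ a ≤ L`. -/
def Sig.stub_tableOrientation : Prop :=
  ∀ L : ℕ, 1 ≤ L → ∀ ε : ℝ, 0 < ε → ∀ δ : ℝ, 0 < δ → ∃ X₀ : ℕ, ∀ X : ℕ, X₀ ≤ X → ∀ P : ℕ, (X : ℝ) ^ δ ≤ (P : ℝ) → (P : ℝ) ≤ (X : ℝ) ^ (1 / 4 : ℝ) → ∀ a : ℤ, 1 ≤ a → a ≤ (L : ℤ) → ∀ k : ℕ, 1 ≤ k → k ≤ L → ∀ Δ : ℤ, Δ ≠ 0 → |Δ| ≤ (L : ℤ) * (X : ℤ) → ∀ e lo hi : ℕ → ℕ, (∀ p : ℕ, hi p * P ≤ L * X) → (∑ p ∈ (Finset.Ioc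 P (2 * P)).filter Nat.Prime, |∑ u ∈ (Finset.Icc (lo p) (hi p)).filter (fun u : ℕ => u ≡ e p [MOD k]), ((ArithmeticFunction.liouville u : ℤ) : ℝ) * ((ArithmeticFunction.liouville (Int.toNat ((a * p * u : ℤ) + Δ)) : ℤ) : ℝ)|) ≤ ε * (X : ℝ) / Real.log (P : ℝ)

/-- Statement of `stub_goldbachOrientation` (G): the door for negative dilations `a = −b`,
`1 ≤ b ≤ L`, positive shifts `0 < Δ ≤ LX`, dilated argument `Δ − bpu`. -/
def Sig.stub_goldbachOrientation : Prop :=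
  ∀ L : ℕ, 1 ≤ L → ∀ ε : ℝ, 0 < ε → ∀ δ : ℝ, 0 < δ → ∃ X₀ : ℕ, ∀ X : ℕ, X₀ ≤ X → ∀ P : ℕ, (X : ℝ) ^ δ ≤ (P : ℝ) → (P : ℝ) ≤ (X : ℝ) ^ (1 / 4 : ℝ) → ∀ b : ℤ, 1 ≤ b → b ≤ (L : ℤ) → ∀ k : ℕ, 1 ≤ k → k ≤ L → ∀ Δ : ℤ, 0 < Δ → Δ ≤ (L : ℤ) * (X : ℤ) → ∀ e lo hi : ℕ → ℕ, (∀ p : ℕ, hi p * P ≤ L * X) → (∑ p ∈ (Finset.Ioc P (2 * P)).filter Nat.Prime, |∑ u ∈ (Finset.Icc (lo p) (hi p)).filter (fun u : ℕ => u ≡ e p [MOD k]), ((ArithmeticFunction.liouville u : ℤ) : ℝ) * ((ArithmeticFunction.liouville (Int.toNat (Δ - (b * p * u : ℤ))) : ℤ) : ℝ)|) ≤ ε * (X : ℝ) / Real.log (P : ℝ)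

/-! ## Registered stubs (`sorry` only here; signatures def-free and self-contained) -/

/-- **T — TABLE ORIENTATION: Chowla on ℓ¹-average over prime multipliers, positive dilations.**
For every `L ≥ 1`, `ε > 0`, `δ > 0` there is `X₀` such that for all `X ≥ X₀`, all `P` with
`X^δ ≤ P ≤ X^{1/4}`, all dilations `1 ≤ a ≤ L`, class moduli `1 ≤ k ≤ L`, shifts `Δ ≠ 0` with
`|Δ| ≤ LX`, and all classes `e(p)` and intervals `[lo p, hi p]` with `hi(p)·P ≤ LX`:
`Σ_{p prime ∈ (P,2P]} |Σ_{u ∈ [lo p, hi p], u ≡ e(p) (k)} λ(u)λ(apu + Δ)| ≤ εX / log P`.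
The `a > 0` half of the crux, verbatim otherwise. Equivalently (`λ(apu) = λ(ap)λ(u)`): two-point
Chowla `λ(n)λ(n + Δ)` at natural density on the class of `n` divisible by `ap` (twisted by a class
mod `apk`), in `ℓ¹`-average over the prime moduli `p ∼ P ∈ [X^δ, X^{1/4}]` — the ascending shifted
multiplication table `λ(ap·u + Δ)` against `λ(u)`. Why it might fail: Chowla-complete from below on
twin-shape pair systems (KataiTransfer at `a₂ > 0`; natural density = LogarithmicAveraging barrier)
and Siegel-complete in `Δ` (`q_exc ∣ Δ`); known only: the one-point shadow (KMT 2019, λ in APs to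
almost all moduli), the log-averaged fixed-coefficient form (Tao 2016, tree fact
`tao_log_chowla_liouville`), shift-averaged forms (MRT 2015). Sources: arXiv:1509.05422,
arXiv:1503.05121, arXiv:1909.12280, Katai1986, BourgainSarnakZiegler2013,
TaoTeravainen2019AlmostAllScales. Size: open-problem. Checked against the landed negatives: keeps
`Δ ≠ 0` (`primeMultiplierChowla_false_without_shiftNonzero`, a T-instance at `Δ = 0`) and the cap
`P ≤ X^{1/4}` (`primeMultiplierChowla_false_without_cap`). -/
theorem stub_tableOrientation : ∀ L : ℕ, 1 ≤ L → ∀ ε : ℝ, 0 < ε → ∀ δ : ℝ, 0 < δ → ∃ X₀ : ℕ, ∀ X : ℕ, X₀ ≤ X → ∀ P : ℕ, (X : ℝ) ^ δ ≤ (P : ℝ) → (P : ℝ) ≤ (X : ℝ) ^ (1 / 4 : ℝ) → ∀ a : ℤ, 1 ≤ a → a ≤ (L : ℤ) → ∀ k : ℕ, 1 ≤ k → k ≤ L → ∀ Δ : ℤ, Δ ≠ 0 → |Δ| ≤ (L : ℤ) * (X : ℤ) → ∀ e lo hi : ℕ → ℕ, (∀ p : ℕ, hi p * P ≤ L * X)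 → (∑ p ∈ (Finset.Ioc P (2 * P)).filter Nat.Prime, |∑ u ∈ (Finset.Icc (lo p) (hi p)).filter (fun u : ℕ => u ≡ e p [MOD k]), ((ArithmeticFunction.liouville u : ℤ) : ℝ) * ((ArithmeticFunction.liouville (Int.toNat ((a * p * u : ℤ) + Δ)) : ℤ) : ℝ)|) ≤ ε * (X : ℝ) / Real.log (P : ℝ) := by
  sorry

/-- **G — GOLDBACH ORIENTATION: Chowla on ℓ¹-average over prime multipliers, negative dilations.**
For every `L ≥ 1`, `ε > 0`, `δ > 0` there is `X₀` such that for all `X ≥ X₀`, all `P` with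
`X^δ ≤ P ≤ X^{1/4}`, all `1 ≤ b ≤ L`, class moduli `1 ≤ k ≤ L`, targets `0 < Δ ≤ LX`, and all
classes `e(p)` and intervals `[lo p, hi p]` with `hi(p)·P ≤ LX`:
`Σ_{p prime ∈ (P,2P]} |Σ_{u ∈ [lo p, hi p], u ≡ e(p) (k)} λ(u)λ(Δ − bpu)| ≤ εX / log P`.
The `a = −b < 0` half of the crux (for `Δ ≤ 0` it is vacuous: every summand is `λ(u)λ(0) = 0`,
`doorTerm_eq_zero`). Equivalently (`λ(bpu) = λ(bp)λ(u)`): the even-Goldbach count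
`Σ_{n + m = Δ} λ(n)λ(m)` restricted to `bp ∣ n` (and a class of `n/(bp)` mod `k`, an interval in
`n`), `o(X / log P)` in `ℓ¹`-average over the prime moduli `p ∼ P`, uniformly in the target
`Δ ≤ LX` — the descending table `λ(Δ − bp·u)` against `λ(u)`; non-trivial only for `Δ ≫ εX/L`-ish
targets (the large-shift "GoldbachRegime" of the route header). Why it might fail: no shift to
average along in this orientation — even the log-averaged fixed-coefficient analogue is not covered
by Tao's entropy decrement; only almost-all-`Δ` results (MRT-type) are known; Siegel-complete in `Δ`
(`q_exc ∣ Δ`). Sources: arXiv:1509.05422, arXiv:1503.05121, arXiv:1909.12280, Katai1986,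
BourgainSarnakZiegler2013, MatomakiMerikoski2023. Size: open-problem. Checked against the landed
negatives: keeps a non-zero (indeed positive) shift and the cap `P ≤ X^{1/4}`. -/
theorem stub_goldbachOrientation : ∀ L : ℕ, 1 ≤ L → ∀ ε : ℝ, 0 < ε → ∀ δ : ℝ, 0 < δ → ∃ X₀ : ℕ, ∀ X : ℕ, X₀ ≤ X → ∀ P : ℕ, (X : ℝ) ^ δ ≤ (P : ℝ) → (P : ℝ) ≤ (X : ℝ) ^ (1 / 4 : ℝ) → ∀ b : ℤ, 1 ≤ b → b ≤ (L : ℤ) → ∀ k : ℕ, 1 ≤ k → k ≤ L → ∀ Δ : ℤ, 0 < Δ → Δ ≤ (L : ℤ) * (X : ℤ) → ∀ e lo hi : ℕ → ℕ, (∀ p : ℕ, hi p * P ≤ L * X) → (∑ p ∈ (Finset.Ioc P (2 * P)).filter Nat.Prime, |∑ u ∈ (Finset.Icc (lo p) (hi p)).filter (fun u : ℕ => u ≡ e p [MOD k]), ((ArithmeticFunction.liouville u : ℤ) : ℝ) * ((ArithmeticFunction.liouville (Int.toNat (Δ - (b * p * u : ℤ))) : ℤ) : ℝ)|) ≤ ε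 * (X : ℝ) / Real.log (P : ℝ) := by
  sorry

/-! ## In-file lemmas for the composition (sorry-free) -/

/-- `λ ∘ Int.toNat` vanishes at non-positive integers (`λ 0 = 0`). -/
theorem liouville_toNat_of_nonpos {x : ℤ} (hx : x ≤ 0) :
    ((ArithmeticFunction.liouville (Int.toNat x) : ℤ) : ℝ) = 0 := by
  have h : Int.toNat x = 0 := Int.toNat_eq_zero.mpr hx
  simp [h]

/-- In the Goldbach orientation (`a < 0`) with a non-positive shift every dilated argument
`apu + Δ` is non-positive. -/
theorem dilatedArg_nonpos {a Δ : ℤ} (ha : a < 0) (hΔ : Δ ≤ 0) (p u : ℕ) :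
    (a * p * u : ℤ) + Δ ≤ 0 := by
  have hpu : (0 : ℤ) ≤ (p : ℤ) * (u : ℤ) := by positivity
  have hapu : a * (p : ℤ) * (u : ℤ) ≤ 0 := by
    rw [mul_assoc]
    exact mul_nonpos_iff.mpr (Or.inr ⟨ha.le, hpu⟩)
  linarith

/-- Sanity / the vacuous corner of the crux: for `a < 0` and `Δ ≤ 0` every summand of the door
vanishes (`λ(u)·λ(toNat(apu + Δ)) = λ(u)·λ(0) = 0`). -/
theorem doorTerm_eq_zero {a Δ : ℤ} (ha : a < 0) (hΔ : Δ ≤ 0) (p u : ℕ) :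
    ((ArithmeticFunction.liouville u : ℤ) : ℝ) *
        ((ArithmeticFunction.liouville (Int.toNat ((a * p * u : ℤ) + Δ)) : ℤ) : ℝ) = 0 := by
  rw [liouville_toNat_of_nonpos (dilatedArg_nonpos ha hΔ p u), mul_zero]

/-- The right-hand side of the door is non-negative (`log P ≥ 0` for a natural number `P`; for
`P ≤ 1` it is `0` and so is the quotient). -/
theorem door_rhs_nonneg {ε : ℝ} (hε : 0 < ε) (X P : ℕ) :
    (0 : ℝ) ≤ ε * (X : ℝ) / Real.log (P : ℝ) :=
  div_nonneg (by positivity) (Real.log_natCast_nonneg P)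

/-! ## Composition: the crux BY NAME from the two stubs (real proof, no `sorry`) -/

/-- **PrimeMultiplierChowla from T and G.** Case split by orientation: `a > 0` is T verbatim;
`a < 0, Δ > 0` is G at `b = −a` after the ring identity `Δ − (−a)pu = apu + Δ` under the sums;
`a < 0, Δ < 0` is the vacuous corner (`doorTerm_eq_zero`, `door_rhs_nonneg`). -/
theorem PrimeMultiplierChowla_of :
    Sig.stub_tableOrientation → Sig.stub_goldbachOrientation → PrimeMultiplierChowla := by
  intro hT hG L hL ε hε δ hδ
  obtain ⟨X₁, hX₁⟩ := hT L hL ε hε δ hδ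
  obtain ⟨X₂, hX₂⟩ := hG L hL ε hε δ hδ
  refine ⟨max X₁ X₂, ?_⟩
  intro X hX P hPlo hPhi a ha haL k hk hkL Δ hΔ hΔL e lo hi hhi
  rcases lt_or_gt_of_ne ha with haneg | hapos
  · -- GOLDBACH orientation: `a < 0`
    rcases lt_or_gt_of_ne hΔ with hΔneg | hΔpos
    · -- vacuous corner: every summand vanishes
      have hzero : ∀ p ∈ (Finset.Ioc P (2 * P)).filter Nat.Prime,
          |∑ u ∈ (Finset.Icc (lo p) (hi p)).filter (fun u : ℕ => u ≡ e p [MOD k]),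
            ((ArithmeticFunction.liouville u : ℤ) : ℝ) *
              ((ArithmeticFunction.liouville (Int.toNat ((a * p * u : ℤ) + Δ)) : ℤ) : ℝ)| = 0 := by
        intro p _
        rw [abs_eq_zero]
        exact Finset.sum_eq_zero fun u _ => doorTerm_eq_zero haneg hΔneg.le p u
      rw [Finset.sum_eq_zero hzero]
      exact door_rhs_nonneg hε X P
    · -- `b = -a`
      have hb1 : 1 ≤ -a := by omega
      have hbL : -a ≤ (L : ℤ) := by
        have h := (abs_le.mp haL).1
        linarith
      have hΔL' : Δ ≤ (L : ℤ) * (X : ℤ) := le_trans (le_abs_self Δ) hΔL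
      have h := hX₂ X (le_of_max_le_right hX) P hPlo hPhi (-a) hb1 hbL k hk hkL Δ hΔpos hΔL'
        e lo hi hhi
      have key : ∀ p u : ℕ, Δ - (-a * (p : ℤ) * (u : ℤ)) = a * (p : ℤ) * (u : ℤ) + Δ := by
        intro p u
        ring
      simp only [key] at h
      exact h
  · -- TABLE orientation: `a > 0`
    have ha1 : 1 ≤ a := by omega
    have haL' : a ≤ (L : ℤ) := le_trans (le_abs_self a) haL
    exact hX₁ X (le_of_max_le_left hX) P hPlo hPhi a ha1 haL' k hk hkL Δ hΔ hΔL e lo hi hhi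

/-- The crux by name, closed modulo the two registered stubs (checks that the `Sig.*` legend is the
stub signatures verbatim). -/
theorem primeMultiplierChowla_of_stubs : PrimeMultiplierChowla :=
  PrimeMultiplierChowla_of stub_tableOrientation stub_goldbachOrientation

end Summit.Parity.GeneralizedHardyLittlewood.Cruxes.PrimeMultiplierChowla.Birth

end
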